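import Literature.Geometry.Kaehler.ComplexTorusPicardNumberEllipticProductsRange
import Literature.Geometry.Kaehler.ComplexTorusPicardNumberGapsGeneral
import Mathlib.Analysis.Real.Sqrt
import Mathlib.Analysis.SpecificLimits.Basic
import HarnessLib

/-!
# Hulek–Laface 2019, Thm. 1.2 = Thm. 7.1: the Picard numbers of abelian varieties are asymptotically
# complete, `δ = lim_{g → ∞} #R_g / g² = 1`

Layer `Literature/Geometry/Kaehler`, namespace `Literature.Geometry.Kaehler.ComplexTorus`; lane
`lit-hodgefound` (Track 2 foundations library), Layer A4 row A4-13 (self-proposed 2026-08-22, seat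
`lit-hodgefound-p18`, generation 7, row g7-#3).  Sequel of `ComplexTorusPicardNumberEllipticProductsRange.lean`
(seat p18, generation 6: HL Remark 6.5, the explicit pairwise non-isogenous CM curves `E_{i√p_k}` — `p_k` the
`k`-th prime — and the curve `E_θ`, `θ = i·2^{1/4}`, without complex multiplication) and of
`ComplexTorusPicardNumberPoincareLength.lean` (Cor. 2.3 as printed, `finrank_neronSeveriGroup_powers`).

Source followed (K. Hulek, R. Laface, *On the Picard numbers of abelian varieties*, Ann. Sc. Norm. Super.
Pisa Cl. Sci. (5) XIX (2019); held text `paper:arxiv-1703.05882`), verbatim: p0002 "we define the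
asymptotic density of Picard numbers to be the quantity `δ := lim_{g → +∞} #R_g / g²`. […] **Theorem 1.2.**
The Picard numbers of abelian varieties are asymptotically complete: `δ = lim_{g → +∞} #R_g / g² = 1`.";
p0011 "`R_g := {ρ | ∃ X abelian variety, dim X = g, ρ(X) = ρ}`."; p0013 "The ratio `δ_g := #R_g / g²` is the
density of `R_g` in `[1, g²] ∩ ℕ` […] **Theorem 7.1** (Asymptotic completeness). The sets of Picard numbers
of abelian varieties are asymptotically dense, i.e. `δ = 1`. The proof relies on Lagrange's four-square
theorem and the following lemma […] **Lemma 7.2.** Suppose `g ≥ 1` and `1 ≤ n ≤ g²` […] Assume that there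
exist positive integers `n_1, …, n_k` such that `n − 1 = n_1² + ⋯ + n_k²` and `n_1 + ⋯ + n_k ≤ g − 1`. Then,
there exists a `g`-dimensional abelian variety `X` with `ρ(X) = n`. […] This implies that all Picard
numbers in the range `[1, b_g)` indeed occur […] Hence, we have that asymptotically
`#R_g ≥ b_g − 1 = g² + 8g − 4√2 g^{3/2}`, and thus `δ = 1`."

## The set `R_g` and the route (recorded deviation)

`R_g` is `ComplexTorus.picardNumbers g`: the Picard numbers `rk NS(X)` of the abelian varieties (complex
tori with a Riemann form, `IsAbelianVariety`) presented on the standard model `X = ℂ^g / X(ℤ^{2g})`,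
`X : ℝ^{2g} ≃ ℂ^g`; EVERY abelian variety `E/Φ(ℤ^ι)` of dimension `g` contributes
(`IsAbelianVariety.mem_picardNumbers`: reindex `ι ≃ Fin 2g`, `E ≃L[ℂ] ℂ^g`, an isomorphism of complex
tori by `isIsomorphic_of_reindex`; `ρ` and projectivity are isogeny invariants).  `R_g ⊆ [0, g²]`
(`ρ ≤ h^{1,1} = g²`).

The paper's lower bound `#R_g ≥ b_g − 1` rests on Lemma 7.2, whose "filler" of the remaining
`g − Σ n_i ≥ 1` dimensions is ONE abelian variety of Picard number `1` (a very general member of `𝒜_s`,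
Prop. 6.3 / 6.4 — a moduli-theoretic existence statement not in the tree), and on Lagrange's four-square
theorem.  Here the lower bound is obtained from PRODUCTS OF ELLIPTIC CURVES ONLY (Cor. 2.3 as printed and
Cor. 2.6, as in Remark 6.5): for pairwise non-isogenous CM curves `E_i` and the non-CM curve `E_θ`,
`ρ(E_θ^d × ∏_i E_i^{e_i}) = C(d+1, 2) + Σ_i e_i²` in dimension `d + Σ_i e_i`
(`choose_add_sum_sq_mem_picardNumbers`).  Writing `n = g + t`, the number `t` is decomposed GREEDILY as
`t = [t odd] + c₁(c₁−1) + c₂(c₂−1) + 2m` with `c₁ = ⌊√t₁⌋` (`t₁` the even part of `t`),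
`c₂ = ⌊√r₁⌋` for the remainder `r₁ ≤ 3c₁`, and `2m = r₂ ≤ 3c₂` — realised by `E_θ^{2[t odd]}` (Picard number
`3 = 2 + 1`), `E_1^{c₁}`, `E_2^{c₂}`, `m` squares `E_j²` and `g − D` single CM curves, total dimension `g` as
soon as `D = 2[t odd] + c₁ + c₂ + 2m ≤ g`, which holds when `⌊√t⌋ + 4⌊√(3⌊√t⌋)⌋ + 2 ≤ g`
(`add_mem_picardNumbers_of_sqrt_le`).  Hence `#R_g ≥ (g − 4⌊√(3g)⌋ − 2)²` (`sq_le_ncard_picardNumbers`), an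
elementary substitute for `b_g − 1` with the same leading term, and `δ = 1` follows by squeezing against
`#R_g ≤ g² + 1` (**`tendsto_ncard_picardNumbers_div_sq`**, Thm. 7.1 / Thm. 1.2 as printed).  The members
`1 ≤ ρ < g` of `R_g` (Prop. 6.4) are neither produced nor needed.

## Contents (one plumbing definition with body — `picardNumbers` —, theorems; no named fact, net debt 0)

* §1 `picardNumbers` (`R_g`), `mem_picardNumbers_iff`, `exists_isIsomorphic_standardModel`,
  **`IsAbelianVariety.mem_picardNumbers`**, `picardNumbers_subset_Iic`, `picardNumbers_finite`,
  `ncard_picardNumbers_le` (`#R_g ≤ g² + 1`).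
* §2 the configuration engine `mixedPowers_im_pos` / `not_isIsogenous_mixedPowers` /
  **`finrank_neronSeveriGroup_mixedPowers`** / **`choose_add_sum_sq_mem_picardNumbers`**
  (`C(d+1,2) + Σ_s e_s² ∈ R_{d + Σ_s e_s}` for every finite family of exponents `e` and every `d`);
  validations `four_mem_picardNumbers_two` (`ρ(E²) = 4`, CM) and `three_mem_picardNumbers_two`
  (`ρ(E_θ²) = 3`, no CM).
* §3 the greedy lower bound **`add_mem_picardNumbers_of_sqrt_le`** and **`sq_le_ncard_picardNumbers`**.
* §4 **Thm. 7.1 `tendsto_ncard_picardNumbers_div_sq`** (`#R_g / g² → 1`).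
* §5 (add-only sequel) **`R_g ⊊ [1, g²] ∩ ℕ` for every `g ≥ 3`**: `IsAbelianVariety.finrank_neronSeveriGroup_pos`
  (`1 ≤ ρ`), `picardNumbers_subset_Icc` (`R_g ⊆ [1, g²]`), Thm. 1.1 read on `R_g`
  (`not_mem_picardNumbers_of_lt_of_lt`, `not_mem_picardNumbers_of_lt_of_lt_secondGap`), the threefold
  case **`IsAbelianVariety.finrank_neronSeveriGroup_le_six_or_eq_nine`** (`ρ ≤ 6 ∨ ρ = 9`),
  `not_mem_picardNumbers_three` (`7, 8 ∉ R_3`), `picardNumbers_three_subset` (`R_3 ⊆ {1,…,6,9}`),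
  `subset_picardNumbers_three` (`{3,4,5,6,9} ⊆ R_3`), **`picardNumbers_ssubset_Icc`** (`R_g ⊊ [1, g²]`,
  `g ≥ 3`) and `ncard_picardNumbers_lt_sq` (`#R_g < g²`).

## References

* [HulekLaface2019PicardNumbersAV] K. Hulek, R. Laface, *On the Picard numbers of abelian varieties*,
  Ann. Sc. Norm. Super. Pisa Cl. Sci. (5) XIX (2019) 1199–1224 (arXiv:1703.05882), Thm. 1.2, §2.1 Cor. 2.3,
  §2.2 Cor. 2.6, §6.1 (`R_g`), §6.2 Prop. 6.4 / Remark 6.5, §7.1 Thm. 7.1, Lemma 7.2.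
* [Lange2023AbelianVarietiesComplex] H. Lange, *Abelian Varieties over the Complex Numbers*, Grundlehren
  Text Edition, Springer (2023), §1.1.1–§1.1.2 (period matrices, products), §1.3.1 Exercise 1.3.4 (10)(b)
  (`ρ ≤ g²`), §2.4.4 Cor. 2.4.26.
-/

noncomputable section

open Module Matrix Function Filter Topology
open Complex (I)

namespace Literature.Geometry.Kaehler

namespace ComplexTorus

/-- The covering space `E ≅ ℝ^ι` of a complex torus is finite-dimensional over `ℂ`. [cite: Lange2023AbelianVarietiesComplex, §1.1.1] -/
private theorem finiteDimensional_complex_of_period {ι : Type*} [Fintype ι] {E : Type*} [NormedAddCommGroup E]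
    [NormedSpace ℂ E] (Φ : (ι → ℝ) ≃L[ℝ] E) : FiniteDimensional ℂ E := by
  haveI : FiniteDimensional ℝ E := LinearEquiv.finiteDimensional Φ.toLinearEquiv
  exact Module.Finite.of_restrictScalars_finite ℝ ℂ E

/-! ## §1 The set `R_g` of Picard numbers of `g`-dimensional abelian varieties -/

section PicardNumbers

/-- **`R_g`, the set of realizable Picard numbers of abelian varieties of dimension `g`**
("`R_g := {ρ | ∃ X abelian variety, dim X = g, ρ(X) = ρ}`"), with the abelian varieties presented on the
standard model `ℂ^g / X(ℤ^{2g})` (period isomorphism `X : ℝ^{2g} ≃ ℂ^g` carrying a Riemann form); every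
abelian variety of dimension `g` contributes (`IsAbelianVariety.mem_picardNumbers`).
[cite: HulekLaface2019PicardNumbersAV, §6.1 (definition of `R_g`) and §1] -/
def picardNumbers (g : ℕ) : Set ℕ :=
  {n | ∃ X : (Fin (2 * g) → ℝ) ≃L[ℝ] (Fin g → ℂ), IsAbelianVariety X ∧ finrank ℤ (neronSeveriGroup X) = n}

/-- Membership in `R_g` (definitional unfolding). [cite: HulekLaface2019PicardNumbersAV, §6.1 (definition of `R_g`)] -/
theorem mem_picardNumbers_iff {g n : ℕ} :
    n ∈ picardNumbers g ↔
      ∃ X : (Fin (2 * g) → ℝ) ≃L[ℝ] (Fin g → ℂ), IsAbelianVariety X ∧ finrank ℤ (neronSeveriGroup X) = n :=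
  Iff.rfl

variable {ι : Type*} [Fintype ι] [DecidableEq ι] {E : Type*} [NormedAddCommGroup E] [NormedSpace ℂ E]

/-- **Every complex torus is isomorphic to one on the standard model `ℂ^g / X(ℤ^{2g})`**: relabel the
lattice basis along `ι ≃ Fin 2g` (`|ι| = 2 dim_ℂ E`) and identify `E ≃L[ℂ] ℂ^g` (a choice of complex
basis, "`X = ℂ^g/Πℤ^{2g}` with a period matrix `Π`"). [cite: Lange2023AbelianVarietiesComplex, §1.1.1 (period matrices), p. 18] -/
theorem exists_isIsomorphic_standardModel (Φ : (ι → ℝ) ≃L[ℝ] E) :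
    ∃ X : (Fin (2 * finrank ℂ E) → ℝ) ≃L[ℝ] (Fin (finrank ℂ E) → ℂ), IsIsomorphic Φ X := by
  haveI : FiniteDimensional ℂ E := finiteDimensional_complex_of_period Φ
  have hcard : Fintype.card ι = Fintype.card (Fin (2 * finrank ℂ E)) := by
    rw [Fintype.card_fin, card_eq_two_mul_finrank Φ]
  let e : ι ≃ Fin (2 * finrank ℂ E) := Fintype.equivOfCardEq hcard
  have hfr : finrank ℂ E = finrank ℂ (Fin (finrank ℂ E) → ℂ) := by rw [Module.finrank_fin_fun]
  let C : E ≃L[ℂ] (Fin (finrank ℂ E) → ℂ) := ContinuousLinearEquiv.ofFinrankEq hfr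
  let X : (Fin (2 * finrank ℂ E) → ℝ) ≃L[ℝ] (Fin (finrank ℂ E) → ℂ) :=
    ((LinearEquiv.funCongrLeft ℝ ℝ e).trans
      (Φ.toLinearEquiv.trans (C.toLinearEquiv.restrictScalars ℝ))).toContinuousLinearEquiv
  have hX : ∀ y, X y = C (Φ fun i ↦ y (e i)) := fun y ↦ rfl
  refine ⟨X, isIsomorphic_of_reindex Φ X e (C : E →L[ℂ] Fin (finrank ℂ E) → ℂ) fun x ↦ ?_⟩
  rw [hX]
  simp only [Equiv.symm_apply_apply, ContinuousLinearEquiv.coe_coe]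

/-- **Every abelian variety of dimension `g` contributes its Picard number to `R_g`** (whatever its
presentation `E/Φ(ℤ^ι)`: the Picard number and projectivity are invariant under the isomorphism onto the
standard model). [cite: HulekLaface2019PicardNumbersAV, §6.1 (definition of `R_g`)] -/
theorem IsAbelianVariety.mem_picardNumbers {Φ : (ι → ℝ) ≃L[ℝ] E} (hX : IsAbelianVariety Φ) :
    finrank ℤ (neronSeveriGroup Φ) ∈ picardNumbers (finrank ℂ E) := by
  obtain ⟨X, hiso⟩ := exists_isIsomorphic_standardModel Φ
  exact ⟨X, hiso.isIsogenous.isAbelianVariety_iff.1 hX, (hiso.isIsogenous.finrank_neronSeveriGroup_eq _ _).symm⟩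

/-- **`R_g ⊆ [0, g²]`** ("`1 ≤ ρ ≤ g²`"; `ρ ≤ h^{1,1} = g²`). [cite: HulekLaface2019PicardNumbersAV, §1 ("`1 ≤ ρ ≤ g²`")] -/
theorem picardNumbers_subset_Iic (g : ℕ) : picardNumbers g ⊆ Set.Iic (g ^ 2) := by
  rintro n ⟨X, -, rfl⟩
  have h := finrank_neronSeveriGroup_le_sq X
  rwa [Module.finrank_fin_fun] at h

/-- `R_g` is finite. [cite: HulekLaface2019PicardNumbersAV, §1 ("`1 ≤ ρ ≤ g²`")] -/
theorem picardNumbers_finite (g : ℕ) : (picardNumbers g).Finite :=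
  (Set.finite_Iic _).subset (picardNumbers_subset_Iic g)

/-- **`#R_g ≤ g² + 1`.** [cite: HulekLaface2019PicardNumbersAV, §7.1 (`δ_g = #R_g / g²`)] -/
theorem ncard_picardNumbers_le (g : ℕ) : (picardNumbers g).ncard ≤ g ^ 2 + 1 := by
  calc (picardNumbers g).ncard ≤ (Set.Iic (g ^ 2)).ncard :=
        Set.ncard_le_ncard (picardNumbers_subset_Iic g) (Set.finite_Iic _)
    _ = g ^ 2 + 1 := by rw [← Finset.coe_Iic, Set.ncard_coe_finset, Nat.card_Iic]

end PicardNumbers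

/-! ## §2 The configuration engine: `ρ(E_θ^d × ∏_s E_{i√p_s}^{e_s}) = C(d+1, 2) + Σ_s e_s²` -/

section Engine

variable {S : Type} [Fintype S] [DecidableEq S]

omit [DecidableEq S] in
/-- The lattice points of the configuration: `none ↦ θ = i·2^{1/4}` (no complex multiplication),
`some s ↦ i√p_s` (distinct primes, complex multiplication), all in the upper half plane.
[cite: HulekLaface2019PicardNumbersAV, §6.2 Remark 6.5 (products of elliptic curves)] -/
theorem mixedPowers_im_pos (o : Option S) :
    0 < (I * (Real.sqrt (o.elim (Real.sqrt 2) fun s ↦ (Nat.nth Nat.Prime (Fintype.equivFin S s) : ℝ)) : ℂ)).im := by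
  cases o with
  | none => exact im_I_mul_sqrt_sqrt_two_pos
  | some s => exact im_I_mul_sqrt_nth_prime_pos _

omit [DecidableEq S] in
/-- The curves of the configuration are pairwise non-isogenous (`E_θ` has no CM, the `E_{i√p_s}` have CM
with distinct endomorphism algebras `ℚ(√−p_s)`). [cite: HulekLaface2019PicardNumbersAV, §6.1 Prop. 6.2] -/
theorem not_isIsogenous_mixedPowers (o o' : Option S) (h : o ≠ o') :
    ¬ IsIsogenous (ellipticPeriod (mixedPowers_im_pos o).ne') (ellipticPeriod (mixedPowers_im_pos o').ne') := by
  rcases o with _ | s <;> rcases o' with _ | s'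
  · exact absurd rfl h
  · exact not_isIsogenous_ellipticPeriod_I_mul_sqrt_sqrt_two_I_mul_sqrt_nth_prime _ _ _
  · exact fun h' ↦ not_isIsogenous_ellipticPeriod_I_mul_sqrt_sqrt_two_I_mul_sqrt_nth_prime _ _ _
      (IsIsogenous.symm _ _ h')
  · exact not_isIsogenous_ellipticPeriod_I_mul_sqrt_nth_prime
      (fun h' ↦ h (congrArg some ((Fintype.equivFin S).injective (Fin.ext h')))) _ _

/-- **The configuration `E_θ^d × ∏_s E_{i√p_s}^{e_s}` has Picard number `C(d+1, 2) + Σ_s e_s²`** for EVERY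
family of exponents `e : S → ℕ` and every `d` (Cor. 2.3 as printed for pairwise non-isogenous simple
factors; Cor. 2.6: `ρ(E_θ^d) = C(d+1, 2)` without CM, `ρ(Eᵉ) = e²` with CM; exponent `0` gives a point).
[cite: HulekLaface2019PicardNumbersAV, §2.1 Cor. 2.3, §2.2 Cor. 2.6 and §6.2 Remark 6.5] -/
theorem finrank_neronSeveriGroup_mixedPowers (e : S → ℕ) (d : ℕ) :
    finrank ℤ (neronSeveriGroup (sigmaPiPeriod fun o : Option S ↦
      powPeriod (ellipticPeriod (mixedPowers_im_pos o).ne') (o.elim d e))) = (d + 1).choose 2 + ∑ s, e s ^ 2 := by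
  rw [finrank_neronSeveriGroup_powers _ _ (fun o ↦ isSimple_ellipticPeriod _)
    (fun o ↦ isAbelianVariety_elliptic (mixedPowers_im_pos o)) (fun o o' h ↦ not_isIsogenous_mixedPowers o o' h),
    Fintype.sum_option]
  have h0 : finrank ℤ (neronSeveriGroup (powPeriod (ellipticPeriod (mixedPowers_im_pos (none : Option S)).ne')
      ((none : Option S).elim d e))) = (d + 1).choose 2 :=
    finrank_neronSeveriGroup_pow_of_not_cm _ (Module.finrank_self ℂ)
      (finrank_endAlgRat_ellipticPeriod_I_mul_sqrt_sqrt_two_ne_two _) d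
  have h1 : ∀ s : S, finrank ℤ (neronSeveriGroup (powPeriod
      (ellipticPeriod (mixedPowers_im_pos (some s)).ne') ((some s : Option S).elim d e))) = e s ^ 2 :=
    fun s ↦ finrank_neronSeveriGroup_pow_of_cm _ (Module.finrank_self ℂ)
      (finrank_endAlgRat_ellipticPeriod_I_mul_sqrt_nth_prime _ _) (e s)
  rw [h0, Finset.sum_congr rfl fun s _ ↦ h1 s]

/-- **`C(d+1, 2) + Σ_s e_s² ∈ R_{d + Σ_s e_s}`**: the configuration `E_θ^d × ∏_s E_{i√p_s}^{e_s}` is an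
abelian variety of dimension `d + Σ_s e_s` (Remark 6.5's mechanism for arbitrary exponents).
[cite: HulekLaface2019PicardNumbersAV, §6.2 Remark 6.5 with §2.1 Cor. 2.3 / §2.2 Cor. 2.6] -/
theorem choose_add_sum_sq_mem_picardNumbers (e : S → ℕ) (d : ℕ) :
    (d + 1).choose 2 + ∑ s, e s ^ 2 ∈ picardNumbers (d + ∑ s, e s) := by
  have hA : IsAbelianVariety (sigmaPiPeriod fun o : Option S ↦
      powPeriod (ellipticPeriod (mixedPowers_im_pos o).ne') (o.elim d e)) :=
    IsAbelianVariety.sigmaPi fun o ↦ (isAbelianVariety_elliptic (mixedPowers_im_pos o)).pow _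
  have hmem := hA.mem_picardNumbers
  rw [finrank_neronSeveriGroup_mixedPowers e d,
    finrank_powers_eq (fun o : Option S ↦ ellipticPeriod (mixedPowers_im_pos o).ne') (fun o ↦ o.elim d e),
    Fintype.sum_option] at hmem
  simpa only [Option.elim_none, Option.elim_some, Module.finrank_self, mul_one] using hmem

/-- Validation: `4 ∈ R_2` — the square of a CM curve (`S = Unit`, `e = 2`, `d = 0`: `C(1,2) + 2² = 4`).
[cite: HulekLaface2019PicardNumbersAV, §1 ("if they also have complex multiplication `ρ = 4`")] -/
theorem four_mem_picardNumbers_two : 4 ∈ picardNumbers 2 := by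
  have h := choose_add_sum_sq_mem_picardNumbers (S := Unit) (fun _ ↦ 2) 0
  simpa using h

/-- Validation: `3 ∈ R_2` — the square of a curve without complex multiplication (`S` empty, `d = 2`:
`C(3,2) = 3`). [cite: HulekLaface2019PicardNumbersAV, §1 ("isogenous but they do not have complex multiplication, then `ρ = 3`")] -/
theorem three_mem_picardNumbers_two : 3 ∈ picardNumbers 2 := by
  have h := choose_add_sum_sq_mem_picardNumbers (S := Fin 0) (fun _ ↦ 0) 2
  simpa using h

end Engine

/-! ## §3 The greedy lower bound `#R_g ≥ (g − 4⌊√(3g)⌋ − 2)²` -/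

section Greedy

/-- `c² − c` is even: `r = t + c − c²` is even when `t` is (the remainders of the greedy steps).
[folklore] -/
private theorem even_add_sub_sq {t c : ℕ} (ht : Even t) (hc : c ^ 2 ≤ t + c) : Even (t + c - c ^ 2) := by
  obtain ⟨a, ha⟩ := ht
  obtain ⟨b, hb⟩ := Nat.even_mul_succ_self c
  rw [Nat.even_iff]
  have hb' : c ^ 2 + c = b + b := by rw [← hb]; ring
  omega

/-- One greedy step: for `c = ⌊√t⌋` the remainder `r = t + c − c²` satisfies `c² ≤ t + c` and `r ≤ 3c`.
[folklore] -/
private theorem greedy_step (t : ℕ) :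
    Nat.sqrt t ^ 2 ≤ t + Nat.sqrt t ∧ t + Nat.sqrt t - Nat.sqrt t ^ 2 ≤ 3 * Nat.sqrt t := by
  have h1 := Nat.sqrt_le' t
  have h2 := Nat.lt_succ_sqrt' t
  constructor
  · omega
  · have : t < Nat.sqrt t ^ 2 + 2 * Nat.sqrt t + 1 := by
      simpa [Nat.succ_eq_add_one, add_sq, mul_comm, mul_assoc] using h2
    omega

/-- **The greedy lower bound: `g + t ∈ R_g` whenever `⌊√t⌋ + 4⌊√(3⌊√t⌋)⌋ + 2 ≤ g`.**  With `t₁` the even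
part of `t`, `c₁ = ⌊√t₁⌋`, `r₁ = t₁ + c₁ − c₁² ≤ 3c₁` (even), `c₂ = ⌊√r₁⌋`, `r₂ = r₁ + c₂ − c₂² ≤ 3c₂` (even,
`= 2m`): the product `E_θ^{2[t odd]} × E_1^{c₁} × E_2^{c₂} × ∏_{j<m} E_{3+j}² × ∏_{k<f} E'_k` of pairwise
non-isogenous elliptic curves (`E_θ` without, all others with complex multiplication; `f = g − D`,
`D = 2[t odd] + c₁ + c₂ + 2m ≤ g`) has dimension `g` and Picard number
`3[t odd] + c₁² + c₂² + 4m + f = g + t` (Cor. 2.3 / Cor. 2.6).  This replaces the paper's Lemma 7.2 +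
Lagrange (whose filler is a very general abelian variety of Picard number `1`) by CM elliptic fillers.
[cite: HulekLaface2019PicardNumbersAV, §7.1 Thm. 7.1 (proof) and Lemma 7.2; §6.2 Remark 6.5] -/
theorem add_mem_picardNumbers_of_sqrt_le {g t : ℕ}
    (h : Nat.sqrt t + 4 * Nat.sqrt (3 * Nat.sqrt t) + 2 ≤ g) : g + t ∈ picardNumbers g := by
  -- the even part `t₁ = 2a` of `t = 2a + ε`, `ε ∈ {0, 1}`
  obtain ⟨a, ε, hε, ht⟩ : ∃ a ε : ℕ, ε ≤ 1 ∧ t = 2 * a + ε := ⟨t / 2, t % 2, by omega, by omega⟩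
  -- first greedy step on `t₁`
  obtain ⟨hc₁le, hr₁le⟩ := greedy_step (2 * a)
  set c₁ := Nat.sqrt (2 * a) with hc₁
  set r₁ := 2 * a + c₁ - c₁ ^ 2 with hr₁
  have hr₁even : Even r₁ := even_add_sub_sq (even_two_mul a) hc₁le
  -- second greedy step on `r₁`
  obtain ⟨hc₂le, hr₂le⟩ := greedy_step r₁
  set c₂ := Nat.sqrt r₁ with hc₂
  set r₂ := r₁ + c₂ - c₂ ^ 2 with hr₂
  have hr₂even : Even r₂ := even_add_sub_sq hr₁even hc₂le
  obtain ⟨m, hm⟩ := hr₂even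
  -- the dimension used by the non-filler blocks is `D = 2ε + c₁ + c₂ + 2m ≤ g`
  have hc₁t : c₁ ≤ Nat.sqrt t := by rw [hc₁]; exact Nat.sqrt_le_sqrt (by omega)
  have hc₂t : c₂ ≤ Nat.sqrt (3 * Nat.sqrt t) := by
    rw [hc₂]
    exact (Nat.sqrt_le_sqrt hr₁le).trans (Nat.sqrt_le_sqrt (Nat.mul_le_mul_left 3 hc₁t))
  have hD : 2 * ε + c₁ + c₂ + (m + m) ≤ g := by omega
  obtain ⟨f, hf⟩ : ∃ f, g = 2 * ε + c₁ + c₂ + (m + m) + f := ⟨g - (2 * ε + c₁ + c₂ + (m + m)), by omega⟩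
  -- the exponents: `c₁, c₂` (indexed by `Bool`), `m` squares, `f` fillers; the non-CM block `E_θ^{2ε}`
  let e : Bool ⊕ (Fin m ⊕ Fin f) → ℕ := Sum.elim (fun b ↦ cond b c₁ c₂) (Sum.elim (fun _ ↦ 2) (fun _ ↦ 1))
  have hsum : ∑ x, e x = c₁ + c₂ + (m + m) + f := by
    rw [Fintype.sum_sum_type, Fintype.sum_sum_type, Fintype.sum_bool]
    simp only [e, Sum.elim_inl, Sum.elim_inr, cond_true, cond_false, Finset.sum_const, Finset.card_univ,
      Fintype.card_fin, smul_eq_mul, mul_one]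
    ring
  have hsq : ∑ x, e x ^ 2 = c₁ ^ 2 + c₂ ^ 2 + 4 * m + f := by
    rw [Fintype.sum_sum_type, Fintype.sum_sum_type, Fintype.sum_bool]
    simp only [e, Sum.elim_inl, Sum.elim_inr, cond_true, cond_false, Finset.sum_const, Finset.card_univ,
      Fintype.card_fin, smul_eq_mul, mul_one, one_pow]
    ring
  have key := choose_add_sum_sq_mem_picardNumbers e (2 * ε)
  rw [hsum, hsq] at key
  -- `C(2ε + 1, 2) = 3ε` for `ε ∈ {0, 1}`
  have hchoose : (2 * ε + 1).choose 2 = 3 * ε := by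
    rcases Nat.le_one_iff_eq_zero_or_eq_one.1 hε with rfl | rfl <;> decide
  rw [hchoose] at key
  -- bookkeeping: the dimension is `g` and the Picard number is `g + t`
  have hdim : 2 * ε + (c₁ + c₂ + (m + m) + f) = g := by omega
  have hρ : 3 * ε + (c₁ ^ 2 + c₂ ^ 2 + 4 * m + f) = g + t := by
    have e1 : c₁ ^ 2 + r₁ = 2 * a + c₁ := by rw [hr₁]; omega
    have e2 : c₂ ^ 2 + r₂ = r₁ + c₂ := by rw [hr₂]; omega
    omega
  rw [hdim, hρ] at key
  exact key

/-- **`#R_g ≥ (g − 4⌊√(3g)⌋ − 2)²`**: every `n = g + t` with `t < (g − 4⌊√(3g)⌋ − 2)²` lies in `R_g`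
(for such `t`, `⌊√t⌋ ≤ g − 4⌊√(3g)⌋ − 3` and `⌊√(3⌊√t⌋)⌋ ≤ ⌊√(3g)⌋`).  The paper's bound is
`#R_g ≥ b_g − 1 = g² + 8g − 4√2 g^{3/2}`; this elementary one has the same leading term `g²`.
[cite: HulekLaface2019PicardNumbersAV, §7.1 Thm. 7.1 (proof: "`#R_g ≥ b_g − 1`")] -/
theorem sq_le_ncard_picardNumbers (g : ℕ) :
    (g - (4 * Nat.sqrt (3 * g) + 2)) ^ 2 ≤ (picardNumbers g).ncard := by
  set M := g - (4 * Nat.sqrt (3 * g) + 2) with hM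
  have hsub : ((Finset.range (M ^ 2)).image fun t ↦ g + t : Set ℕ) ⊆ picardNumbers g := by
    intro n hn
    rw [Finset.coe_image, Set.mem_image] at hn
    obtain ⟨t, ht, rfl⟩ := hn
    rw [Finset.mem_coe, Finset.mem_range] at ht
    apply add_mem_picardNumbers_of_sqrt_le
    have h1 : Nat.sqrt t < M := Nat.sqrt_lt'.2 ht
    have h2 : Nat.sqrt t ≤ g := by omega
    have h3 : Nat.sqrt (3 * Nat.sqrt t) ≤ Nat.sqrt (3 * g) := Nat.sqrt_le_sqrt (Nat.mul_le_mul_left 3 h2)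
    omega
  calc M ^ 2 = ((Finset.range (M ^ 2)).image fun t ↦ g + t).card := by
        rw [Finset.card_image_of_injective _ fun t t' h ↦ Nat.add_left_cancel h, Finset.card_range]
    _ = ((Finset.range (M ^ 2)).image fun t ↦ g + t : Set ℕ).ncard := (Set.ncard_coe_finset _).symm
    _ ≤ (picardNumbers g).ncard := Set.ncard_le_ncard hsub (picardNumbers_finite g)

end Greedy

/-! ## §4 Thm. 7.1 (= Thm. 1.2): asymptotic completeness, `#R_g / g² → 1` -/

section Asymptotics

/-- The error term `a_g = 4⌊√(3g)⌋ + 2` is `o(g)`: `a_g / g → 0`. [cite: HulekLaface2019PicardNumbersAV, §7.1 Thm. 7.1 (proof)] -/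
private theorem tendsto_error_div :
    Tendsto (fun g : ℕ ↦ ((4 * Nat.sqrt (3 * g) + 2 : ℕ) : ℝ) / (g : ℝ)) atTop (𝓝 0) := by
  -- `0 ≤ a_g / g ≤ 4√3 / √g + 2 / g` for `g ≥ 1`
  have hup : Tendsto (fun g : ℕ ↦ 4 * Real.sqrt 3 * (Real.sqrt (g : ℝ))⁻¹ + 2 / (g : ℝ)) atTop (𝓝 0) := by
    have h1 : Tendsto (fun g : ℕ ↦ (Real.sqrt (g : ℝ))⁻¹) atTop (𝓝 0) :=
      tendsto_inv_atTop_zero.comp (Real.tendsto_sqrt_atTop.comp tendsto_natCast_atTop_atTop)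
    have h2 : Tendsto (fun g : ℕ ↦ (2 : ℝ) / (g : ℝ)) atTop (𝓝 0) := tendsto_const_div_atTop_nhds_zero_nat 2
    simpa using (h1.const_mul (4 * Real.sqrt 3)).add h2
  refine squeeze_zero' (Eventually.of_forall fun g ↦ by positivity) ?_ hup
  filter_upwards [eventually_ge_atTop 1] with g hg
  have hg' : (0 : ℝ) < g := by exact_mod_cast hg
  have hsq : (0 : ℝ) < Real.sqrt g := Real.sqrt_pos.2 hg'
  have hns : ((Nat.sqrt (3 * g) : ℕ) : ℝ) ≤ Real.sqrt 3 * Real.sqrt g := by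
    calc ((Nat.sqrt (3 * g) : ℕ) : ℝ) ≤ Real.sqrt ((3 * g : ℕ) : ℝ) := Real.nat_sqrt_le_real_sqrt
      _ = Real.sqrt 3 * Real.sqrt g := by rw [Nat.cast_mul, Nat.cast_ofNat, Real.sqrt_mul (by norm_num)]
  rw [div_le_iff₀ hg']
  have hgs : Real.sqrt (g : ℝ) * Real.sqrt g = g := Real.mul_self_sqrt hg'.le
  calc (((4 * Nat.sqrt (3 * g) + 2 : ℕ)) : ℝ) = 4 * ((Nat.sqrt (3 * g) : ℕ) : ℝ) + 2 := by push_cast; ring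
    _ ≤ 4 * (Real.sqrt 3 * Real.sqrt g) + 2 := by linarith
    _ = (4 * Real.sqrt 3 * (Real.sqrt (g : ℝ))⁻¹ + 2 / (g : ℝ)) * g := by
        field_simp
        nlinarith [hgs]

/-- **Hulek–Laface 2019, Thm. 7.1 = Thm. 1.2 (Asymptotic completeness), as printed: "The Picard numbers of
abelian varieties are asymptotically complete: `δ = lim_{g → +∞} #R_g / g² = 1`."**  Squeeze:
`(g − 4⌊√(3g)⌋ − 2)² ≤ #R_g ≤ g² + 1` (`sq_le_ncard_picardNumbers`, `ncard_picardNumbers_le`).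
[cite: HulekLaface2019PicardNumbersAV, Thm. 1.2 and §7.1 Thm. 7.1] -/
theorem tendsto_ncard_picardNumbers_div_sq :
    Tendsto (fun g : ℕ ↦ ((picardNumbers g).ncard : ℝ) / (g : ℝ) ^ 2) atTop (𝓝 1) := by
  -- the error term and the two bounds
  set a : ℕ → ℕ := fun g ↦ 4 * Nat.sqrt (3 * g) + 2 with ha
  have herr : Tendsto (fun g : ℕ ↦ ((a g : ℕ) : ℝ) / (g : ℝ)) atTop (𝓝 0) := tendsto_error_div
  -- lower bound `(1 − a_g/g)² → 1`
  have hlow : Tendsto (fun g : ℕ ↦ (1 - ((a g : ℕ) : ℝ) / (g : ℝ)) ^ 2) atTop (𝓝 1) := by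
    have := (tendsto_const_nhds (x := (1 : ℝ))).sub herr
    simpa using this.pow 2
  -- upper bound `(g² + 1)/g² = 1 + 1/g² → 1`
  have hupp : Tendsto (fun g : ℕ ↦ 1 + ((g : ℝ) ^ 2)⁻¹) atTop (𝓝 1) := by
    have h : Tendsto (fun g : ℕ ↦ ((g : ℝ) ^ 2)⁻¹) atTop (𝓝 0) :=
      tendsto_inv_atTop_zero.comp ((tendsto_pow_atTop two_ne_zero).comp (tendsto_natCast_atTop_atTop (R := ℝ)))
    simpa using (tendsto_const_nhds (x := (1 : ℝ))).add h
  -- eventually `a_g < g`, so that the `ℕ`-subtraction is a real subtraction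
  have hev : ∀ᶠ g : ℕ in atTop, a g < g := by
    have h1 : ∀ᶠ g : ℕ in atTop, ((a g : ℕ) : ℝ) / (g : ℝ) < 1 := (tendsto_order.1 herr).2 1 one_pos
    filter_upwards [h1, eventually_ge_atTop 1] with g hlt hg
    have hg' : (0 : ℝ) < g := by exact_mod_cast hg
    rw [div_lt_one hg'] at hlt
    exact_mod_cast hlt
  refine tendsto_of_tendsto_of_tendsto_of_le_of_le' hlow hupp ?_ ?_
  · filter_upwards [hev, eventually_ge_atTop 1] with g hag hg
    have hg' : (0 : ℝ) < g := by exact_mod_cast hg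
    have hle := sq_le_ncard_picardNumbers g
    have hcast : ((g - a g : ℕ) : ℝ) = (g : ℝ) - ((a g : ℕ) : ℝ) := Nat.cast_sub hag.le
    calc (1 - ((a g : ℕ) : ℝ) / (g : ℝ)) ^ 2 = (((g - a g : ℕ) : ℝ)) ^ 2 / (g : ℝ) ^ 2 := by
          rw [hcast]
          field_simp
      _ ≤ ((picardNumbers g).ncard : ℝ) / (g : ℝ) ^ 2 := by
          gcongr
          exact_mod_cast hle
  · filter_upwards [eventually_ge_atTop 1] with g hg
    have hg' : (0 : ℝ) < g := by exact_mod_cast hg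
    have hle : ((picardNumbers g).ncard : ℝ) ≤ (g : ℝ) ^ 2 + 1 := by exact_mod_cast ncard_picardNumbers_le g
    calc ((picardNumbers g).ncard : ℝ) / (g : ℝ) ^ 2 ≤ ((g : ℝ) ^ 2 + 1) / (g : ℝ) ^ 2 := by gcongr
      _ = 1 + ((g : ℝ) ^ 2)⁻¹ := by field_simp

end Asymptotics

/-! ## §5 `R_g ⊊ [1, g²] ∩ ℕ` for every `g ≥ 3`: `1 ≤ ρ`, the gaps of Thm. 1.1 read on `R_g`, and `R_3` -/

section NotComplete

variable {ι : Type*} [Fintype ι] [DecidableEq ι] {E : Type*} [NormedAddCommGroup E] [NormedSpace ℂ E]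

omit [DecidableEq ι] in
/-- **`1 ≤ ρ(X)` for an abelian variety of positive dimension**: a polarization is a nonzero element of the
free `ℤ`-module `NS(X)` (`E(iu, u) > 0` for `u ≠ 0`). [cite: HulekLaface2019PicardNumbersAV, §1 ("the Picard number, satisfies the inequality `1 ≤ ρ(X) ≤ h^{1,1}(X)`")] -/
theorem IsAbelianVariety.finrank_neronSeveriGroup_pos [Nontrivial E] {Φ : (ι → ℝ) ≃L[ℝ] E}
    (hX : IsAbelianVariety Φ) : 0 < finrank ℤ (neronSeveriGroup Φ) := by
  haveI := moduleFinite_neronSeveriGroup Φ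
  haveI := moduleFree_neronSeveriGroup Φ
  obtain ⟨ω, hω⟩ := hX
  obtain ⟨u, hu⟩ := exists_ne (0 : E)
  have hne : ω ≠ 0 := fun h ↦ by
    have := hω.2.2 u hu
    rw [h] at this
    simp at this
  rw [Module.finrank_pos_iff]
  exact ⟨⟨0, ⟨ω, mem_neronSeveriGroup_of_isRiemannForm Φ hω⟩, fun h ↦ hne (Subtype.ext_iff.1 h).symm⟩⟩

/-- **`R_g ⊆ [1, g²]` for `g ≥ 1`** ("`1 ≤ ρ ≤ g²`"). [cite: HulekLaface2019PicardNumbersAV, §1 ("By the above we know that `1 ≤ ρ ≤ g²`")] -/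
theorem picardNumbers_subset_Icc {g : ℕ} (hg : 1 ≤ g) : picardNumbers g ⊆ Set.Icc 1 (g ^ 2) := by
  rintro n ⟨X, hX, rfl⟩
  refine ⟨?_, picardNumbers_subset_Iic g ⟨X, hX, rfl⟩⟩
  haveI : Nontrivial (Fin g → ℂ) := by
    haveI : Nonempty (Fin g) := ⟨⟨0, hg⟩⟩
    infer_instance
  exact hX.finrank_neronSeveriGroup_pos

/-- **Thm. 1.1 (1) on `R_g`: for `g ≥ 4`, `R_g ∩ ((g−1)² + 1, g²) = ∅`.** [cite: HulekLaface2019PicardNumbersAV, Thm. 1.1 (1)] -/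
theorem not_mem_picardNumbers_of_lt_of_lt {g n : ℕ} (hg : 4 ≤ g) (h₁ : (g - 1) ^ 2 + 1 < n) (h₂ : n < g ^ 2) :
    n ∉ picardNumbers g := by
  rintro ⟨X, hX, rfl⟩
  have h := hX.not_lt_finrank_neronSeveriGroup_lt (by rw [Module.finrank_fin_fun]; exact hg)
  rw [Module.finrank_fin_fun] at h
  exact h ⟨h₁, h₂⟩

/-- **Thm. 1.1 (2) on `R_g`: for `g ≥ 7`, `R_g ∩ ((g−2)² + 4, (g−1)² + 1) = ∅`.** [cite: HulekLaface2019PicardNumbersAV, Thm. 1.1 (2)] -/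
theorem not_mem_picardNumbers_of_lt_of_lt_secondGap {g n : ℕ} (hg : 7 ≤ g) (h₁ : (g - 2) ^ 2 + 4 < n)
    (h₂ : n < (g - 1) ^ 2 + 1) : n ∉ picardNumbers g := by
  rintro ⟨X, hX, rfl⟩
  have h := hX.not_lt_finrank_neronSeveriGroup_lt_secondGap (by rw [Module.finrank_fin_fun]; exact hg)
  rw [Module.finrank_fin_fun] at h
  exact h ⟨h₁, h₂⟩

/-- **Abelian threefolds: `ρ(A) ≤ 6` or `ρ(A) = 9`** ("`R_3 = {1, …, 6, 9}` […] This phenomenon had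
previously been noticed by Shioda"): along a Poincaré decomposition, `r(A) ≥ 2` gives `ρ ≤ M_{2,3} = 5`
(Prop. 3.1), `A ∼ E³` gives `ρ ∈ {9, 6}` (Cor. 2.6), and a simple threefold has `ρ ≤ dim_ℚ End_ℚ ≤ 6`.
[cite: HulekLaface2019PicardNumbersAV, §1 ("it is not hard to show that `R_3 = {1, …, 6, 9}`")] -/
theorem IsAbelianVariety.finrank_neronSeveriGroup_le_six_or_eq_nine {A : (ι → ℝ) ≃L[ℝ] E}
    (hAV : IsAbelianVariety A) (hg : finrank ℂ E = 3) :
    finrank ℤ (neronSeveriGroup A) ≤ 6 ∨ finrank ℤ (neronSeveriGroup A) = 9 := by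
  obtain ⟨ω, hω⟩ := hAV
  obtain ⟨r, V, hV, hVc, n, hVpos, hVs, hVab, hVV, hn, hiso⟩ := IsRiemannForm.exists_isIsogenous_powers_pos A hω
  haveI : ∀ ν, Nonempty (Fin (subRank (V ν))) := fun ν ↦ ⟨⟨0, hVpos ν⟩⟩
  set X : ∀ ν : Fin r, (Fin (subRank (V ν)) → ℝ) ≃L[ℝ] cxSpan A (V ν) :=
    fun ν ↦ subtorusPeriod A (V ν) (hV ν) (hVc ν) with hXdef
  haveI : ∀ ν, FiniteDimensional ℂ (cxSpan A (V ν)) := fun ν ↦ finiteDimensional_complex_of_period (X ν)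
  rcases Nat.lt_or_ge r 2 with hr | hr
  · -- `r(A) = 1` (`r = 0` would make `A` a point)
    have hr1 : Fintype.card (Fin r) = 1 := by
      rw [Fintype.card_fin]
      rcases Nat.lt_or_ge r 1 with h0 | h0
      · exfalso
        have : r = 0 := by omega
        subst this
        have hE : finrank ℂ E = 0 := by
          rw [hiso.finrank_eq _ _, finrank_powers_eq X n, Finset.univ_eq_empty, Finset.sum_empty]
        omega
      · omega
    obtain ⟨ν₀, huniq⟩ := Fintype.card_eq_one_iff.1 hr1
    letI : Unique (Fin r) := { default := ν₀, uniq := huniq }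
    have hAX : IsIsogenous A (powPeriod (X ν₀) (n ν₀)) :=
      IsIsogenous.trans _ _ _ hiso (isIsomorphic_sigmaPiPeriod_unique fun ν ↦ powPeriod (X ν) (n ν)).isIsogenous
    have hdim : finrank ℂ E = n ν₀ * finrank ℂ (cxSpan A (V ν₀)) := by
      rw [hAX.finrank_eq _ _, Module.finrank_pi_fintype, Finset.sum_const, Finset.card_univ, Fintype.card_fin,
        smul_eq_mul]
    by_cases hd : finrank ℂ (cxSpan A (V ν₀)) = 1
    · -- `A ∼ E³`: `ρ ∈ {9, C(4,2) = 6}`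
      rcases hiso.finrank_neronSeveriGroup_eq_sq_or_eq_choose_of_card_eq_one X n hr1
        (fun ν ↦ by rw [huniq ν]; exact hd) with h | h
      · exact Or.inr (by rw [h, hg]; norm_num)
      · exact Or.inl (by rw [h, hg]; decide)
    · -- `A ∼ X¹` with `X` a simple threefold: `ρ(A) = ρ(X) ≤ dim_ℚ End_ℚ(X) ≤ 6`
      have hb : 0 < finrank ℂ (cxSpan A (V ν₀)) := finrank_pos_of_nonempty (X ν₀)
      have hn0 : n ν₀ = 1 := by
        have h0 := hn ν₀
        rw [hg] at hdim
        rcases Nat.lt_or_ge (n ν₀) 2 with h2 | h2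
        · omega
        · exfalso
          have : 2 * finrank ℂ (cxSpan A (V ν₀)) ≤ 3 := by
            calc 2 * finrank ℂ (cxSpan A (V ν₀)) ≤ n ν₀ * finrank ℂ (cxSpan A (V ν₀)) :=
                Nat.mul_le_mul_right _ h2
              _ = 3 := hdim.symm
          omega
      rw [hn0] at hAX
      have hAX1 : IsIsogenous A (X ν₀) :=
        IsIsogenous.trans _ _ _ hAX (isIsomorphic_powPeriod_one (X ν₀)).symm.isIsogenous
      refine Or.inl ?_
      rw [hAX1.finrank_neronSeveriGroup_eq _ _]
      calc finrank ℤ (neronSeveriGroup (X ν₀)) ≤ 2 * finrank ℂ (cxSpan A (V ν₀)) :=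
          (hVs ν₀).finrank_neronSeveriGroup_le_two_mul_finrank (hVab ν₀)
        _ = 2 * 3 := by rw [← hAX1.finrank_eq _ _, hg]
        _ = 6 := rfl
  · -- `r(A) ≥ 2`: `ρ ≤ M_{2,3} = 5`
    have h := hiso.finrank_neronSeveriGroup_le_sq_pred_add_one_of_two_le_card X n hVs hVab hVV hn
      (by rw [Fintype.card_fin]; exact hr)
    rw [hg] at h
    exact Or.inl (by omega)

/-- **`7 ∉ R_3` and `8 ∉ R_3`** ("`R_3 = {1, …, 6, 9}`": the first instance of a gap, Shioda's
phenomenon). [cite: HulekLaface2019PicardNumbersAV, §1 ("`R_3 = {1, …, 6, 9}`")] -/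
theorem not_mem_picardNumbers_three {n : ℕ} (h₁ : 6 < n) (h₂ : n ≠ 9) : n ∉ picardNumbers 3 := by
  rintro ⟨X, hX, rfl⟩
  rcases hX.finrank_neronSeveriGroup_le_six_or_eq_nine (by rw [Module.finrank_fin_fun]) with h | h
  · omega
  · exact h₂ h

/-- **`R_3 ⊆ {1, …, 6, 9}`.** [cite: HulekLaface2019PicardNumbersAV, §1 ("`R_3 = {1, …, 6, 9}`")] -/
theorem picardNumbers_three_subset : picardNumbers 3 ⊆ Set.Icc 1 6 ∪ {9} := by
  intro n hn
  have h1 := picardNumbers_subset_Icc (by norm_num : 1 ≤ 3) hn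
  by_cases h9 : n = 9
  · exact Or.inr h9
  · refine Or.inl ⟨h1.1, ?_⟩
    by_contra h6
    exact not_mem_picardNumbers_three (by omega) h9 hn

/-- **`{3, 4, 5, 6, 9} ⊆ R_3`** by products of elliptic curves (`E_1 × E_2 × E_3`, `E_θ² × E`, `E² × E'`,
`E_θ³`, `E³`; Cor. 2.3 / Cor. 2.6); the members `1, 2` of `R_3` (a very general abelian threefold, a very
general surface times a curve) are not produced here. [cite: HulekLaface2019PicardNumbersAV, §1 ("all other Picard numbers can be obtained by using suitable products of elliptic curves")] -/
theorem subset_picardNumbers_three : ({3, 4, 5, 6, 9} : Set ℕ) ⊆ picardNumbers 3 := by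
  intro n hn
  simp only [Set.mem_insert_iff, Set.mem_singleton_iff] at hn
  rcases hn with rfl | rfl | rfl | rfl | rfl
  · simpa using choose_add_sum_sq_mem_picardNumbers (S := Fin 3) (fun _ ↦ 1) 0
  · simpa using choose_add_sum_sq_mem_picardNumbers (S := Unit) (fun _ ↦ 1) 2
  · simpa using choose_add_sum_sq_mem_picardNumbers (S := Bool) (fun b ↦ cond b 2 1) 0
  · have h6 : Nat.choose 4 2 = 6 := by decide
    simpa [h6] using choose_add_sum_sq_mem_picardNumbers (S := Fin 0) (fun _ ↦ 0) 3
  · simpa using choose_add_sum_sq_mem_picardNumbers (S := Unit) (fun _ ↦ 3) 0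

/-- **"The set `R_g` of realizable Picard numbers of abelian varieties of dimension `g` is not complete for
every `g ≥ 3`, namely `R_g ⊊ [1, g²] ∩ ℕ`"**: `g² − 1 ∉ R_g` for `g ≥ 4` (Thm. 1.1 (1)) and `8 ∉ R_3`.
[cite: HulekLaface2019PicardNumbersAV, Abstract and §1 ("the sets `R_g` are not complete for every `g ≥ 3`")] -/
theorem picardNumbers_ssubset_Icc {g : ℕ} (hg : 3 ≤ g) : picardNumbers g ⊂ Set.Icc 1 (g ^ 2) := by
  refine ⟨picardNumbers_subset_Icc (by omega), fun h ↦ ?_⟩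
  have hg2 : 9 ≤ g ^ 2 := by nlinarith
  have hmem : g ^ 2 - 1 ∈ Set.Icc 1 (g ^ 2) := ⟨by omega, Nat.sub_le _ _⟩
  rcases (show 4 ≤ g ∨ g = 3 by omega) with h4 | rfl
  · refine not_mem_picardNumbers_of_lt_of_lt h4 ?_ (by omega) (h hmem)
    obtain ⟨c, rfl⟩ : ∃ c, g = c + 4 := ⟨g - 4, by omega⟩
    rw [show c + 4 - 1 = c + 3 by omega]
    have : (c + 3) ^ 2 + 1 + 1 ≤ (c + 4) ^ 2 - 1 := by
      rw [show (c + 4) ^ 2 = (c + 3) ^ 2 + 2 * c + 7 by ring]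
      omega
    omega
  · exact not_mem_picardNumbers_three (by norm_num) (by norm_num) (h hmem)

/-- **`#R_g < g²` for every `g ≥ 3`** ("`δ_g < 1` for every `g ≥ 3`"). [cite: HulekLaface2019PicardNumbersAV, §7.1 ("`#R_g < g²`")] -/
theorem ncard_picardNumbers_lt_sq {g : ℕ} (hg : 3 ≤ g) : (picardNumbers g).ncard < g ^ 2 := by
  have h := Set.ncard_lt_ncard (picardNumbers_ssubset_Icc hg) (Set.finite_Icc _ _)
  rwa [← Finset.coe_Icc, Set.ncard_coe_finset, Nat.card_Icc, Nat.add_sub_cancel] at h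

end NotComplete

end ComplexTorus

end Literature.Geometry.Kaehler

end
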